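import Literature.AlgebraicGeometry.ShimuraVarieties.KudlaRapoport2013.Sec13SelfDualLatticeSemilocalBasis
import Literature.AlgebraicGeometry.ShimuraVarieties.KudlaRapoport2013.Sec13HermitianGramCongruence
import HarnessLib

/-!
# [KudlaRapoport2013, §13.2 after Def. 13.5 (arXiv v2 p. 50)] «if `L` is a self-dual `O_k`-module, then `L/NL` is isomorphic to `(O_k/N O_k)ⁿ`
# with the standard form» — DISCHARGED: `KR2013_13_5_reduction_holds`

Kernel-lane companion of the statement carpet ★ `Literature/AlgebraicGeometry/ShimuraVarieties/KudlaRapoport2013/Sec13LevelStructures.lean`: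
its CLOSED named fact ★ `KR2013_13_5_reduction` is PROVED here.  THEOREMS ONLY (no definition, no named fact, no `sorry`, no instance, no
notation); cell hodgecm-mathlib, seat B-typ01 (g33); net debt −1.

## The argument

For `N = 1` everything is congruent modulo `O_k` (take `e = 0`).  For `N > 1` odd and prime to `Δ`, `𝔫 = N O_k` is a non-zero proper `σ`-stable
ideal, so ★ `SemilocalBasis.exists_generators_mod_ideal` (O'Meara §81:3, §82F over the semilocal principal ring `S⁻¹O_k`) gives `e₁, …, e_n ∈ L`
with (a) `Σ O_k e_i + 𝔫L = L`, (b) independence modulo `𝔫`, and an integral Gram matrix `G`, `G_{ij} = (e_j, e_i)`, `σ`-hermitian with `det G` a unit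
modulo `N`.  By ★ `HermitianGram.exists_congr_stdHermMatrix_mod` (Jacobowitz at the `σ`-stable primes of `N`, the adjugate trick at the split ones,
Chinese-remainder gluing) there is `T ∈ M_n(O_k)` with `ᵗ(σT) G T ≡ antidiag(1, …, 1) (mod 𝔫)`; `T` is invertible modulo `𝔫` (determinants), and
`e'_j = Σ_i T_{ij} e_i` satisfies (a), (b) and (c) `(e'_i, e'_j) ≡ h(ē_i, ē_j) (mod 𝔫)`.

## References
* [KudlaRapoport2013] S. Kudla, M. Rapoport, *Special cycles on unitary Shimura varieties II: global theory*, J. reine angew. Math. 697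
  (2014) 91–157 = arXiv:0912.3758v2, §13.2 Def. 13.5 and the sentence after it (p. 50).
* [Omeara1963] O. T. O'Meara, *Introduction to quadratic forms* (1963), §81:3, §82F–§82G.
* [Jacobowitz1962] R. Jacobowitz, *Hermitian forms over local fields*, Amer. J. Math. 84 (1962) 441–465, §7 Thm. 7.1.
-/

set_option autoImplicit false

noncomputable section

open NumberField
open Literature.NumberTheory.Automorphic.Liu2021.AppendixC (conj)
open Literature.AlgebraicGeometry.ShimuraVarieties.KudlaRapoport2013.Sec2Defs (sigmaInt)
open Literature.AlgebraicGeometry.ShimuraVarieties.KudlaRapoport2013.Sec3ComplexUniformization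
  (krForm IsHermitianFor IsFullLattice IsSelfDualFor LatticeDatum)
open scoped Matrix

namespace Literature.AlgebraicGeometry.ShimuraVarieties.KudlaRapoport2013.Sec13LevelStructures

/-! ### The hermitian pairing `(x, y) = σ(y)ᵀ J x` (★ `krForm`): sesquilinearity -/

section KrForm

variable {k : Type} [Field k] [NumberField k] [IsTotallyComplex k] [Algebra.IsQuadraticExtension ℚ k]
variable {n : ℕ} (J : Matrix (Fin n) (Fin n) k)

/-- Additivity of `(x, y)` in `x`. [folklore] -/
private theorem krForm_add_left (x x' y : Fin n → k) :
    krForm (conj ℚ k : k →+* k) J (x + x') y = krForm (conj ℚ k : k →+* k) J x y + krForm (conj ℚ k : k →+* k) J x' y := by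
  simp [krForm, Matrix.mulVec_add, dotProduct_add]

/-- `k`-linearity of `(x, y)` in `x`. [folklore] -/
private theorem krForm_smul_left (c : k) (x y : Fin n → k) :
    krForm (conj ℚ k : k →+* k) J (c • x) y = c * krForm (conj ℚ k : k →+* k) J x y := by
  simp [krForm, Matrix.mulVec_smul, dotProduct_smul]

/-- `(0, y) = 0`. [folklore] -/
private theorem krForm_zero_left (y : Fin n → k) : krForm (conj ℚ k : k →+* k) J 0 y = 0 := by
  simp [krForm]

/-- Additivity of `(x, y)` in `y`. [folklore] -/
private theorem krForm_add_right (x y y' : Fin n → k) :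
    krForm (conj ℚ k : k →+* k) J x (y + y') = krForm (conj ℚ k : k →+* k) J x y + krForm (conj ℚ k : k →+* k) J x y' := by
  have h : (⇑(conj ℚ k : k →+* k) ∘ (y + y')) = (⇑(conj ℚ k : k →+* k) ∘ y) + (⇑(conj ℚ k : k →+* k) ∘ y') := by
    funext i; simp
  rw [krForm, krForm, krForm, h, add_dotProduct]

/-- `σ`-antilinearity of `(x, y)` in `y`. [folklore] -/
private theorem krForm_smul_right (c : k) (x y : Fin n → k) :
    krForm (conj ℚ k : k →+* k) J x (c • y) = conj ℚ k c * krForm (conj ℚ k : k →+* k) J x y := by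
  have h : (⇑(conj ℚ k : k →+* k) ∘ (c • y)) = conj ℚ k c • (⇑(conj ℚ k : k →+* k) ∘ y) := by
    funext i; simp
  rw [krForm, krForm, h, smul_dotProduct, smul_eq_mul]

/-- `(x, 0) = 0`. [folklore] -/
private theorem krForm_zero_right (x : Fin n → k) : krForm (conj ℚ k : k →+* k) J x 0 = 0 := by
  have h : (⇑(conj ℚ k : k →+* k) ∘ (0 : Fin n → k)) = 0 := by funext i; simp
  rw [krForm, h, zero_dotProduct]

/-- Finite sums in the first variable. [folklore] -/
private theorem krForm_sum_left {ι : Type*} (s : Finset ι) (x : ι → Fin n → k) (y : Fin n → k) :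
    krForm (conj ℚ k : k →+* k) J (∑ i ∈ s, x i) y = ∑ i ∈ s, krForm (conj ℚ k : k →+* k) J (x i) y := by
  classical
  induction s using Finset.induction_on with
  | empty => simp [krForm_zero_left]
  | insert a s ha ih => rw [Finset.sum_insert ha, Finset.sum_insert ha, krForm_add_left, ih]

/-- Finite sums in the second variable. [folklore] -/
private theorem krForm_sum_right {ι : Type*} (s : Finset ι) (x : Fin n → k) (y : ι → Fin n → k) :
    krForm (conj ℚ k : k →+* k) J x (∑ i ∈ s, y i) = ∑ i ∈ s, krForm (conj ℚ k : k →+* k) J x (y i) := by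
  classical
  induction s using Finset.induction_on with
  | empty => simp [krForm_zero_right]
  | insert a s ha ih => rw [Finset.sum_insert ha, Finset.sum_insert ha, krForm_add_right, ih]

/-- `σ` is an involution of `k`. [folklore] -/
private theorem conj_conj' (x : k) : conj ℚ k (conj ℚ k x) = x := by
  letI : IsCMField k := IsCMField.ofCMExtension ℚ k
  exact IsCMField.complexConj_apply_apply (K := k) x

/-- `sigmaInt` is `σ` on `O_k`. [folklore] -/
private theorem coe_sigmaInt (a : 𝓞 k) : ((sigmaInt k a : 𝓞 k) : k) = conj ℚ k a := rfl

/-- **Hermitian symmetry of the pairing**: `σ((x, y)) = (y, x)` when `σ(J_{ab}) = J_{ba}`. [folklore] -/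
private theorem conj_krForm (hJ : IsHermitianFor (conj ℚ k : k →+* k) J) (x y : Fin n → k) :
    conj ℚ k (krForm (conj ℚ k : k →+* k) J x y) = krForm (conj ℚ k : k →+* k) J y x := by
  have hJ' : ∀ i j, conj ℚ k (J i j) = J j i := hJ
  simp only [krForm, dotProduct, Matrix.mulVec, Function.comp_apply, RingHom.coe_coe, map_sum, map_mul, Finset.mul_sum]
  rw [Finset.sum_comm]
  refine Finset.sum_congr rfl fun a _ => Finset.sum_congr rfl fun b _ => ?_
  rw [conj_conj', hJ']
  ring

end KrForm

/-! ### The discharge -/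

/-- **Change of generators**: `Σ_j c_j e'_j = Σ_i (T c)_i e_i` for `e'_j = Σ_i T_{ij} e_i`. [folklore] -/
private theorem sum_smul_sum_eq {k : Type} [Field k] {n : ℕ} (T : Matrix (Fin n) (Fin n) (𝓞 k)) (e : Fin n → Fin n → k)
    (c : Fin n → 𝓞 k) :
    (∑ j, (c j : k) • ∑ i, (T i j : k) • e i) = ∑ i, ((T.mulVec c i : 𝓞 k) : k) • e i := by
  simp only [Finset.smul_sum, smul_smul, Matrix.mulVec, dotProduct]
  rw [Finset.sum_comm]
  refine Finset.sum_congr rfl fun i _ => ?_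
  rw [← Finset.sum_smul]
  congr 1
  push_cast
  exact Finset.sum_congr rfl fun j _ => mul_comm _ _

/-- ★ `KR2013_13_5_reduction` HOLDS. [KudlaRapoport2013, §13.2 after Def. 13.5 (arXiv v2 p. 50)]: «if `L` is a self-dual `O_k`-module, then `L/NL`
is isomorphic to `(O_k/N O_k)ⁿ` with the standard form» (`N` odd, prime to `Δ`) — semilocal unimodular basis (★ `SemilocalBasis.exists_generators_mod_ideal`,
O'Meara §81:3/§82F) followed by the congruence of its Gram matrix to `antidiag(1, …, 1)` modulo `N` (★ `HermitianGram.exists_congr_stdHermMatrix_mod`,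
Jacobowitz + Chinese remainder). [cite: KudlaRapoport2013, §13.2 (arXiv v2 p. 50)] -/
theorem KR2013_13_5_reduction_holds : KR2013_13_5_reduction := by
  intro k _ _ _ _ n N hN hN0 hcop X hJ hL hLd
  classical
  -- the standard form has entries `0, 1`
  have hstd : ∀ i j, ((stdHermMatrix n (𝓞 k) i j : 𝓞 k) : k) = stdHermMatrix n k i j := by
    intro i j
    simp only [stdHermMatrix, Matrix.of_apply]
    split_ifs <;> simp
  have hstdt : ∀ i j, stdHermMatrix n (𝓞 k) i j = stdHermMatrix n (𝓞 k) j i := by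
    intro i j
    simp only [stdHermMatrix, Matrix.of_apply]
    exact if_congr (by omega) rfl rfl
  set 𝔫 : Ideal (𝓞 k) := Ideal.span {((N : ℤ) : 𝓞 k)} with h𝔫
  -- `N = 1`
  by_cases hN1 : N = 1
  · have htop : 𝔫 = ⊤ := by rw [h𝔫, hN1]; simp
    refine ⟨fun _ => 0, fun _ => X.L.zero_mem, ?_, fun a _ i => by rw [htop]; exact Submodule.mem_top, fun i j => ?_⟩
    · rw [htop, Submodule.top_smul]
      exact sup_eq_right.2 (Submodule.span_le.2 (by rintro _ ⟨i, rfl⟩; exact X.L.zero_mem))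
    · refine ⟨-stdHermMatrix n (𝓞 k) i j, by rw [htop]; exact Submodule.mem_top, ?_⟩
      rw [krForm_zero_left]
      push_cast
      linear_combination hstd i j
  -- `N > 1`: `𝔫` is a non-zero proper `σ`-stable ideal
  have h𝔫0 : 𝔫 ≠ ⊥ := by
    rw [h𝔫, Ne, Ideal.span_singleton_eq_bot]
    exact_mod_cast hN0.ne'
  have h𝔫1 : 𝔫 ≠ ⊤ := by
    rw [h𝔫, Ne, Ideal.span_singleton_eq_top]
    intro hu
    have h := Literature.NumberTheory.QuadraticFields.Quadratic.isUnit_of_isUnit_intCast (K := k) hu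
    have h2 : ((N : ℤ)).natAbs = 1 := Int.natAbs_of_isUnit h
    omega
  have hσ𝔫 : ∀ x ∈ 𝔫, sigmaInt k x ∈ 𝔫 := by
    intro x hx
    rw [h𝔫, Ideal.mem_span_singleton'] at hx ⊢
    obtain ⟨c, rfl⟩ := hx
    exact ⟨sigmaInt k c, by rw [map_mul, map_intCast]⟩
  -- PIECE 1: semilocal unimodular generators inside `L`
  obtain ⟨e, G, heL, _hli, ha, hb, hG, hGdet⟩ := SemilocalBasis.exists_generators_mod_ideal 𝔫 h𝔫0 h𝔫1 hσ𝔫 hL hLd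
  -- `G` is `σ`-hermitian
  have hGherm : (G.map (sigmaInt k))ᵀ = G := by
    refine Matrix.ext fun i j => RingOfIntegers.ext ?_
    rw [Matrix.transpose_apply, Matrix.map_apply, coe_sigmaInt, hG, hG, conj_krForm X.J hJ]
  -- PIECE 2a: `ᵗ(σT) G T ≡ antidiag (mod 𝔫)`
  obtain ⟨T, hT⟩ := HermitianGram.exists_congr_stdHermMatrix_mod k hN hN0 hcop G hGherm hGdet
  set P : Matrix (Fin n) (Fin n) (𝓞 k) := (T.map (sigmaInt k))ᵀ * G * T with hP
  set A : Matrix (Fin n) (Fin n) (𝓞 k) := stdHermMatrix n (𝓞 k) with hA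
  have hPA : P.map (Ideal.Quotient.mk 𝔫) = A.map (Ideal.Quotient.mk 𝔫) := by
    ext i j
    rw [Matrix.map_apply, Matrix.map_apply, Ideal.Quotient.eq]
    exact hT i j
  -- `T` is invertible modulo `𝔫`: `S = u · adj T`
  have hTdet : IsUnit (Ideal.Quotient.mk 𝔫 T.det) := by
    have hAdet : IsUnit A.det := by
      refine IsUnit.of_mul_eq_one A.det ?_
      rw [← Matrix.det_mul]
      have hAA : A * A = 1 := by
        refine Matrix.ext fun i j => ?_
        have hi : n - 1 - (i : ℕ) < n := by omega
        rw [Matrix.mul_apply, Finset.sum_eq_single ⟨n - 1 - (i : ℕ), hi⟩]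
        · simp only [hA, stdHermMatrix, Matrix.of_apply, Matrix.one_apply, Fin.ext_iff]
          have h1 : (i : ℕ) + (n - 1 - (i : ℕ)) + 1 = n := by omega
          rw [if_pos h1, one_mul]
          exact if_congr (by constructor <;> intro h <;> omega) rfl rfl
        · intro l _ hl
          simp only [hA, stdHermMatrix, Matrix.of_apply]
          rw [if_neg, zero_mul]
          intro h
          apply hl
          exact Fin.ext (by simp only; omega)
        · intro h
          exact absurd (Finset.mem_univ _) h
      rw [hAA, Matrix.det_one]
    have h1 : Ideal.Quotient.mk 𝔫 P.det = Ideal.Quotient.mk 𝔫 A.det := by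
      rw [RingHom.map_det, RingHom.map_det, RingHom.mapMatrix_apply, RingHom.mapMatrix_apply, hPA]
    have h2 : IsUnit (Ideal.Quotient.mk 𝔫 P.det) := by rw [h1]; exact hAdet.map _
    rw [hP, Matrix.det_mul, Matrix.det_mul, map_mul, map_mul] at h2
    exact isUnit_of_mul_isUnit_right h2
  obtain ⟨u, hu⟩ : ∃ u : 𝓞 k, T.det * u - 1 ∈ 𝔫 := by
    obtain ⟨w, hw⟩ := isUnit_iff_exists_inv.1 hTdet
    obtain ⟨u, rfl⟩ := Ideal.Quotient.mk_surjective w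
    exact ⟨u, by rw [← Ideal.Quotient.eq, map_mul, map_one]; exact hw⟩
  set S : Matrix (Fin n) (Fin n) (𝓞 k) := u • T.adjugate with hS
  have hTS : ∀ i j, (T * S) i j - (1 : Matrix (Fin n) (Fin n) (𝓞 k)) i j ∈ 𝔫 := by
    intro i j
    rw [hS, Matrix.mul_smul, Matrix.mul_adjugate, smul_smul, Matrix.smul_apply, Matrix.one_apply, smul_eq_mul]
    split_ifs
    · rw [mul_one, mul_comm]; exact hu
    · rw [mul_zero, sub_zero]; exact 𝔫.zero_mem
  have hST : ∀ i j, (S * T) i j - (1 : Matrix (Fin n) (Fin n) (𝓞 k)) i j ∈ 𝔫 := by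
    intro i j
    rw [hS, Matrix.smul_mul, Matrix.adjugate_mul, smul_smul, Matrix.smul_apply, Matrix.one_apply, smul_eq_mul]
    split_ifs
    · rw [mul_one, mul_comm]; exact hu
    · rw [mul_zero, sub_zero]; exact 𝔫.zero_mem
  -- the new generators
  set e' : Fin n → (Fin n → k) := fun j => ∑ i, (T i j : k) • e i with he'
  have he'L : ∀ j, e' j ∈ X.L := fun j => Submodule.sum_mem _ fun i _ => X.L.smul_mem (T i j) (heL i)
  have hsum : ∀ c : Fin n → 𝓞 k, (∑ j, (c j : k) • e' j) = ∑ i, ((T.mulVec c i : 𝓞 k) : k) • e i :=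
    fun c => sum_smul_sum_eq T e c
  refine ⟨e', he'L, ?_, ?_, ?_⟩
  · -- (a)
    refine le_antisymm (sup_le (Submodule.span_le.2 (by rintro _ ⟨j, rfl⟩; exact he'L j)) Submodule.smul_le_right) ?_
    refine ha.symm.le.trans (sup_le ?_ le_sup_right)
    refine Submodule.span_le.2 ?_
    rintro _ ⟨l, rfl⟩
    -- `e_l = Σ_j S_{jl} e'_j − Σ_i (TS − 1)_{il} e_i`
    have h2 : ∀ i, T.mulVec (fun j => S j l) i = (T * S) i l := fun i => by
      simp only [Matrix.mulVec, dotProduct, Matrix.mul_apply]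
    have h1 : (∑ j, (S j l : k) • e' j) = e l + ∑ i, (((T * S - 1 : Matrix (Fin n) (Fin n) (𝓞 k)) i l : 𝓞 k) : k) • e i := by
      rw [hsum (fun j => S j l)]
      have h3 : ∀ i, ((T.mulVec (fun j => S j l) i : 𝓞 k) : k) • e i =
          (((T * S - 1 : Matrix (Fin n) (Fin n) (𝓞 k)) i l : 𝓞 k) : k) • e i + (if i = l then e i else 0) := by
        intro i
        rw [h2, Matrix.sub_apply, Matrix.one_apply]
        split_ifs with h
        · push_cast
          rw [sub_smul, one_smul, sub_add_cancel]
        · rw [sub_zero, add_zero]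
      rw [Finset.sum_congr rfl fun i _ => h3 i, Finset.sum_add_distrib, Finset.sum_ite_eq' Finset.univ l,
        if_pos (Finset.mem_univ _), add_comm]
    have h3 : e l = (∑ j, (S j l : k) • e' j) - ∑ i, (((T * S - 1 : Matrix (Fin n) (Fin n) (𝓞 k)) i l : 𝓞 k) : k) • e i := by
      rw [h1, add_sub_cancel_right]
    rw [h3]
    refine Submodule.sub_mem _ (Submodule.mem_sup_left (Submodule.sum_mem _ fun j _ =>
      Submodule.smul_mem _ _ (Submodule.subset_span ⟨j, rfl⟩))) (Submodule.mem_sup_right (Submodule.sum_mem _ fun i _ => ?_))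
    exact Submodule.smul_mem_smul (hTS i l) (heL i)
  · -- (b)
    intro a hmem j
    rw [hsum a] at hmem
    have hTa : ∀ i, T.mulVec a i ∈ 𝔫 := hb _ hmem
    have h1 : a j = (S.mulVec (T.mulVec a)) j - ((S * T - 1 : Matrix (Fin n) (Fin n) (𝓞 k)).mulVec a) j := by
      rw [Matrix.mulVec_mulVec, Matrix.sub_mulVec, Matrix.one_mulVec, Pi.sub_apply, sub_sub_cancel]
    rw [h1]
    change (∑ i, S j i * T.mulVec a i) - (∑ i, (S * T - 1 : Matrix (Fin n) (Fin n) (𝓞 k)) j i * a i) ∈ 𝔫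
    refine 𝔫.sub_mem (Ideal.sum_mem _ fun i _ => Ideal.mul_mem_left _ _ (hTa i))
      (Ideal.sum_mem _ fun i _ => Ideal.mul_mem_right _ _ (hST j i))
  · -- (c)
    intro i j
    refine ⟨P j i - A j i, hT j i, ?_⟩
    have hform : krForm (conj ℚ k : k →+* k) X.J (e' i) (e' j) = (P j i : k) := by
      have hL : krForm (conj ℚ k : k →+* k) X.J (e' i) (e' j) =
          ∑ a, ∑ b, (T a i : k) * (conj ℚ k (T b j : k) * (G b a : k)) := by
        change krForm (conj ℚ k : k →+* k) X.J (∑ a, (T a i : k) • e a) (∑ b, (T b j : k) • e b) = _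
        rw [krForm_sum_left]
        refine Finset.sum_congr rfl fun a _ => ?_
        rw [krForm_smul_left, krForm_sum_right, Finset.mul_sum]
        refine Finset.sum_congr rfl fun b _ => ?_
        rw [krForm_smul_right, ← hG]
      have hR : ((P j i : 𝓞 k) : k) = ∑ a, ∑ b, conj ℚ k (T b j : k) * (G b a : k) * (T a i : k) := by
        rw [hP]
        simp only [Matrix.mul_apply, Matrix.transpose_apply, Matrix.map_apply, Finset.sum_mul, map_sum, map_mul,
          RingOfIntegers.coe_eq_algebraMap]
        rfl
      rw [hL, hR]
      refine Finset.sum_congr rfl fun a _ => Finset.sum_congr rfl fun b _ => ?_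
      ring
    rw [hform]
    push_cast
    rw [← hstd, hstdt i j, hA]
    ring

end Literature.AlgebraicGeometry.ShimuraVarieties.KudlaRapoport2013.Sec13LevelStructures

end
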